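import Mathlib
import HarnessLib
import Summits.ValiantsHypothesis.ValiantsHypothesis.Theses.MonotoneRestoration
import Literature.Computability.AlgebraicComplexity.ArithCircuit
import Literature.Computability.AlgebraicComplexity.ArithCircuitProofs
import Literature.Computability.AlgebraicComplexity.MonotoneStructure
import Literature.Computability.AlgebraicComplexity.PermanentIrreducible
import Literature.ModelTheory.FiniteModelTheory.CkEquiv
import Summits.ValiantsHypothesis.ValiantsHypothesis.Theorems.MonotoneRestorationMonotoneRestorationQPCosetCount
import Summits.ValiantsHypothesis.ValiantsHypothesis.Theorems.MonotoneRestorationMonotoneRestorationQPSymmetricLB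
import Summits.ValiantsHypothesis.ValiantsHypothesis.Theorems.MonotoneRestorationMonotoneRestorationQPSupportSymmetrisation
import Summits.ValiantsHypothesis.ValiantsHypothesis.Theorems.MonotoneRestorationMonotoneRestorationQPSparseRegime
import Summits.ValiantsHypothesis.ValiantsHypothesis.Theorems.MonotoneRestorationMonotoneRestorationQPBeta
import Literature.Computability.AlgebraicComplexity.SymmetricArithCircuit
import Literature.Computability.AlgebraicComplexity.DawarWilsenach2025Proofs
import Literature.GroupTheory.PermutationGroups.SmallIndexSubgroups
import Summits.ValiantsHypothesis.ValiantsHypothesis.Theorems.MonotoneRestorationQP.Negative.LoadBearing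
import Summits.ValiantsHypothesis.ValiantsHypothesis.Theorems.MonotoneRestorationMonotoneRestorationQPPermSupportCount

/-! TTRL-lite variant V19214 of stmt-ValiantsHypothesis-15886 -/

set_option linter.dupNamespace false

namespace Summit.ValiantsHypothesis.ValiantsHypothesis.Theorems

open Summit.ValiantsHypothesis.ValiantsHypothesis.Theses.MonotoneRestoration
open Literature.Computability.AlgebraicComplexity

/-- TTRL-lite variant V19214 (n = 4 kernel of row-multilinearity): in the row-sum substitution
`X i ↦ ∑ j, X (i, j)` of `esymm (Fin 4) ℝ≥0 2`, the monomial `X (0,0) * X (0,1)` (row `0` used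
twice) has coefficient `0`.  Proof: with the row-`0` weight `w (i, j) = [i = 0]`, every summand
`∏ i ∈ t, ∑ j, X (i, j)` is `w`-homogeneous of weight `[0 ∈ t] ≤ 1`, while the monomial has
`w`-weight `2`. -/
theorem stub_esymmRowSums_structure_var19214 :
    MvPolynomial.coeff (Finsupp.single ((0 : Fin 4), (0 : Fin 4)) 1 +
        Finsupp.single ((0 : Fin 4), (1 : Fin 4)) 1)
      (MvPolynomial.bind₁ (fun i : Fin 4 => ∑ j : Fin 4, MvPolynomial.X (i, j))
        (MvPolynomial.esymm (Fin 4) NNReal 2)) = 0 := by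
  classical
  -- row-0 weight: every row sum `∑ j, X (i, j)` is homogeneous of weight `[i = 0]`
  have hrow : ∀ i : Fin 4, MvPolynomial.IsWeightedHomogeneous
      (fun p : Fin 4 × Fin 4 => if p.1 = 0 then (1 : ℕ) else 0)
      (∑ j : Fin 4, (MvPolynomial.X (i, j) : MvPolynomial (Fin 4 × Fin 4) NNReal))
      (if i = 0 then (1 : ℕ) else 0) := by
    intro i
    refine MvPolynomial.IsWeightedHomogeneous.sum _ _ _ fun j _ => ?_
    exact MvPolynomial.isWeightedHomogeneous_X NNReal
      (fun p : Fin 4 × Fin 4 => if p.1 = 0 then (1 : ℕ) else 0) (i, j)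
  rw [MvPolynomial.esymm, map_sum, MvPolynomial.coeff_sum]
  refine Finset.sum_eq_zero fun t _ => ?_
  rw [map_prod]
  simp only [MvPolynomial.bind₁_X_right]
  refine (MvPolynomial.IsWeightedHomogeneous.prod t _ _ fun i _ => hrow i).coeff_eq_zero _ ?_
  rw [Finset.sum_ite_eq', map_add, Finsupp.weight_single, Finsupp.weight_single]
  simp only [one_smul, if_true]
  split_ifs <;> simp

end Summit.ValiantsHypothesis.ValiantsHypothesis.Theorems
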